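/-
Copyright (c) 2026 the pub-hodgecm-mathlib formalisation cell (harness21).  Prover seat hodgecm-mathlib-LH4-p03 (g4) on line LH3 (closer stub `stub_N9`, N9 «Transf» road),
organ J «(J-HEAD) ASSEMBLER» (LH3-plan (g3) RULINGS #4 (c) 2026-09-02T07:40:37Z); 2026-09-02.
-/
import Literature.NumberTheory.Rogawski1990.ArchHCOrbitalFamilyGExt      -- ★ p850216 (LH3-p02 (g2)) (G′-EXT): `orbFamGExt`; brings ★ `ArchHCSpaceG` (`ArchHcJump`, `HcSemireg`, `hcNrm`, `hcCayPt`, `.order_zero`), ★ `ArchTransfFamily` ED. 2 (`slotSign`, `AgreesOnAdmissibleCoveredSlots`), ★ `ArchBouazizSpace` (`IsCoveredWall`)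
import Literature.NumberTheory.Rogawski1990.ArchBouazizStableFamily      -- ★ p849717 (LH3-p01 (g3)): `stOrbFamH`; brings ★ `ArchBouazizJumpClause` (`ArchBzJump.order_zero`), ★ (COORD) `nrm`, `cayPt`
import Literature.NumberTheory.Automorphic.Shelstad1979.OneSidedJumpUnique -- ★ p850311 (F0P3a-p04 (g22)) (J-KIT-U): `HasOneSidedJump.unique` (RULINGS #6 (d): reuse, do not retype)
import HarnessLib

/-!
# Organ J of the N9 «Transf» direct road, ASSEMBLED FROM NAMED BRICKS: the junction `jcH S w = 2 · jc′ S w 0 2` of the two jump-constant systems at every admissible covered wall,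
# from the memberships (HC), (BZ), ONE jumping test function per side with non-zero Cayley value ((JH), (JG′)), and the bookkeeping `cH = 2·cG′` ((BOOK))
# (Shelstad 1979 Prop. 4.5, Thm. 4.7; Bouaziz 1994 §3.2 (I₃), Rem. 2; Rogawski 1990 §8.2 Prop. 8.2.1)

Topic `NumberTheory/Rogawski1990`; namespace `Literature.NumberTheory.Rogawski1990`.  THEOREMS ONLY (no `def`, no instance, no notation, no axiom, no named fact, no `sorry`);
kernel lane `--supports stmt-HodgeConjecture-24833`.  Cell `pub/hodgecm-mathlib` (D-0151), crux H413 = `stmt-HodgeConjecture-24833`; line LH3 (closer stub `stub_N9`), leaf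
`F0_P3c_StubN9Direct` skeleton v3 organ **J** `JumpAgreementStatement` (conclusion `AgreesOnAdmissibleCoveredSlots L α jc′ jcH`); LH3-plan (g3) RULINGS #4 (c) «(J-HEAD)
ASSEMBLER = organ J FROM NAMED BRICKS, sorry-free, interfaces fixed NOW».  This file fixes WHAT the analytic bricks (J-H) LH10-p02 (g3), (J-G′-JUMP)∕(G′-CAY)
LH7-p01∕LH3-p02∕F0P3a-p08, (NONDEG-H) LH5-p04 (g2), (N1) LH2-p04 (g3), (NONDEG-G′) must deliver, and turns them into J by pure bookkeeping.  HONEST LABEL: HC_CM is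
proved only modulo the 7 printed citations (2 remaining: hLiu418 = stmt-HodgeConjecture-24832, h413 = stmt-HodgeConjecture-24833) until rung 0 closes; count-neutral: organ J is
proved here only MODULO its bricks, which enter as hypotheses (no `sorry`, no named fact).

THE MATHEMATICS (LH4-p03 (g4) J-CENSUS v1 §(i)–(iii) + (J-BOOK) by hand, LH3-plan (g3) 07:24:10Z «=»).  Fix an admissible `H`-chart `S` (`S ⊆ splitChartPlaces L α`), a
COVERED compact place `w ∉ S` (indefinite: `slotSign L α w` not constant, so slots `0, 1` carry the even lines and slot `2` the odd one — `slotSign w 0 ≠ slotSign w 2`, the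
wall `(w, 0, 2)` is NONCOMPACT) and a semiregular point `s` of the wall `s w 0 = s w 2` (★ `HcSemireg S w 0 2 s`; it implies the `H`-side regularity of ★ `ArchBzJump`).  The
membership (BZ) `stOrbFamH νH fH ∈ Bz(jcH)` read at ORDER 0 (★ `ArchBzJump.order_zero`) says: `ν ↦ stOrbFamH … S (s + ν·nrm w)` has one-sided limits with jump
`jcH S w · stOrbFamH … (insert w S) (cayPt w s)`; the brick (JH) exhibits ONE `fH` whose jump is `cH · (the same Cayley value)` with the Cayley value `≠ 0`
(`cH = 2i·C₁∕C₂`: (K0±) ★ p849935 + (A0-b) ★ p850189∕p850218 + (PROD-QUOT-H) + the STABLE doubling `γ, γ″` of the flip sum); one-sided limits are unique, so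
`jcH S w = cH`.  Symmetrically (HC) `orbFamGExt ν′ a′ ∈ HC(jc′)` at order 0 (★ `ArchHcJump.order_zero`, the twisted currency `archERhoG·F` of ★ (G′-EXT-DOCKS)) and (JG′)
(ONE `a′`, jump `cG′·(twisted Cayley value)`, Cayley value `≠ 0`; `cG′ = i·C₁∕C₂` by descent to `M ≅ U(1,1)×U(1)`) give `jc′ S w 0 2 = cG′`; and (BOOK) `cH = 2·cG′`
(★ wall factors p850207 + the rank-one currencies) closes `jcH S w = 2·jc′ S w 0 2` — the literal text of ★ `AgreesOnAdmissibleCoveredSlots`.  NON-VANISHING TEST FUNCTIONS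
ARE LOAD-BEARING: without `≠ 0` the two readings `jc·v = c·v` do not pin `jc` (this is why (N1)∕(NONDEG) are bricks of J, not named hypotheses of the leaf).

* §1 generic pins (group-free; any family `Ψ` ∕ `F`; uniqueness of one-sided jumps = ★ `HasOneSidedJump.unique`, p850311): **`jcH_eq_of_hasOneSidedJump`**, **`jc'_eq_of_hasOneSidedJump`**,
  `hcSemireg_zero_two_hreg` (the `H`-side regularity from `HcSemireg`);
* §2 the covered-wall guard: `slotSign_zero_ne_slotSign_two` (indefinite ⇒ the `(0,2)` wall is noncompact);
* §3 **`agreesOnAdmissibleCoveredSlots_of_bricks`** — organ J from (HC)(BZ)(BRICKS := ∃ semiregular point, (JH), (JG′), (BOOK)); + `…_of_bricks'` with the weaker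
  (I₃)-only memberships.

## References
* [Shelstad1979] D. Shelstad, *Characters and inner forms of a quasi-split group over ℝ*, Compositio Math. 39 (1979), §4: Lemma 4.3 p. 25, Prop. 4.5 p. 26 (`d(α)`), Thm. 4.7
  (IIIb) p. 31 (the jump relations with explicit constants).
* [Bouaziz1994IntegralesOrbitales] A. Bouaziz, *Intégrales orbitales sur les groupes de Lie réductifs*, Ann. Sci. ÉNS 27 (1994), §3.2 (I₃) p. 580, Rem. 2 p. 594 («Transf»).
* [Rogawski1990] J. D. Rogawski, *Automorphic Representations of Unitary Groups in Three Variables*, Ann. of Math. Stud. 123 (1990), §8.2 Prop. 8.2.1 (c) p. 119 (`γ, γ″`: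
  the stable doubling at a wall of the compact Cartan), §4.3 (4.3.1) p. 43.
-/

set_option autoImplicit false

noncomputable section

open Filter Topology Complex Finset MeasureTheory NumberField NumberField.InfinitePlace
open scoped Classical
open Literature.NumberTheory.Automorphic Literature.NumberTheory.Automorphic.UnitaryGroup Literature.NumberTheory.Automorphic.ArchCartan
open Literature.NumberTheory.Automorphic.Shelstad1979.StableOrbitalIntegrals
open Literature.NumberTheory.GaloisRepresentations

namespace Literature.NumberTheory.Rogawski1990

/-! ## §1 Generic pins: one-sided jumps are unique, so a jumping test function with non-zero Cayley value PINS the constant -/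

section Generic

variable {W : Type*} [Fintype W] [DecidableEq W]

/-- **THE `H`-SIDE PIN (group-free)**: if `Ψ` satisfies Bouaziz's (I₃) with constants `jcH` (★ `ArchBzJump`), and at a compact wall point `s` of the chart `S` (wall `s w₀ 0 = s w₀ 2`,
regular elsewhere) the family member `ν ↦ Ψ S (s + ν·nrm w₀)` jumps by `cH · Ψ (insert w₀ S) (cayPt w₀ s)` with the Cayley value `≠ 0`, then `jcH S w₀ = cH`
(★ `ArchBzJump.order_zero` + uniqueness of one-sided limits + cancellation). [cite: Bouaziz1994IntegralesOrbitales, §3.2 (I₃) p. 580] [cite: Shelstad1979, Thm. 4.7 (IIIb) (p. 31)] -/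
theorem jcH_eq_of_hasOneSidedJump {jcH : Finset W → W → ℂ} {Ψ : Finset W → (W → Fin 3 → ℝ) → ℂ} (hBZ : ArchBzJump jcH Ψ)
    {S : Finset W} {w₀ : W} (hw₀ : w₀ ∉ S) {s : W → Fin 3 → ℝ} (hs : s w₀ 0 = s w₀ 2)
    (hreg : ∀ w, w ∉ S → w ≠ w₀ → Circle.exp (s w 0) ≠ Circle.exp (s w 2)) (hregS : ∀ w ∈ S, s w 0 ≠ 0) {cH : ℂ}
    (hJ : HasOneSidedJump (fun ν : ℝ => Ψ S (s + ν • nrm w₀)) (cH * Ψ (insert w₀ S) (cayPt w₀ s)))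
    (hne : Ψ (insert w₀ S) (cayPt w₀ s) ≠ 0) : jcH S w₀ = cH :=
  mul_right_cancel₀ hne ((hBZ.order_zero hw₀ hs hreg hregS).unique hJ)

/-- **THE `G′`-SIDE PIN (group-free)**: if `F` satisfies Harish-Chandra's (I₃) with constants `jc′` and sign pattern `sgn` (★ `ArchHcJump`), and at a semiregular point `p` of the
NONCOMPACT wall `(w, i, j)` of the chart `S′` the TWISTED member `ν ↦ eρ′_{S′}·F S′` along `p + ν·hcNrm w i j` jumps by `cG · (eρ′_{S′∪w}·F (insert w S′))(hcCayPt w i j p)` with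
`F (insert w S′) (hcCayPt w i j p) ≠ 0`, then `jc′ S′ w i j = cG` (★ `ArchHcJump.order_zero`, the currency of ★ (G′-EXT-DOCKS) at order 0; `eρ′ ≠ 0` ★ `norm_archERhoG`).
[cite: Shelstad1979, Prop. 4.5 (p. 26); Thm. 4.7 (p. 31)] [cite: Bouaziz1994IntegralesOrbitales, §3.2 (I₃) p. 580] -/
theorem jc'_eq_of_hasOneSidedJump {sgn : W → Fin 3 → SignType} {jc' : Finset W → W → Fin 3 → Fin 3 → ℂ} {F : Finset W → (W → Fin 3 → ℝ) → ℂ}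
    (hHC : ArchHcJump sgn jc' F) {S' : Finset W} {w : W} (hw : w ∉ S') {i j : Fin 3} (hij : i ≠ j) (hsg : sgn w i ≠ sgn w j)
    {p : W → Fin 3 → ℝ} (hp : HcSemireg S' w i j p) {cG : ℂ}
    (hJ : HasOneSidedJump (fun ν : ℝ => archERhoG S' (p + ν • hcNrm w i j) * F S' (p + ν • hcNrm w i j))
      (cG * (archERhoG (insert w S') (hcCayPt w i j p) * F (insert w S') (hcCayPt w i j p))))
    (hne : F (insert w S') (hcCayPt w i j p) ≠ 0) : jc' S' w i j = cG := by
  have hρ : archERhoG (insert w S') (hcCayPt w i j p) ≠ 0 :=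
    norm_ne_zero_iff.1 (by rw [norm_archERhoG]; exact one_ne_zero)
  exact mul_right_cancel₀ (mul_ne_zero hρ hne) ((hHC.order_zero hw hij hsg hp).unique hJ)

omit [Fintype W] [DecidableEq W] in
/-- The `H`-side regularity hypotheses of ★ `ArchBzJump.order_zero` at a `G`-semiregular point of the wall `(w, 0, 2)` (★ `HcSemireg S w 0 2 s`): on the wall, `H`-regular at the
other compact places (injectivity of the three exponentials gives `e^{i s w′ 0} ≠ e^{i s w′ 2}`), `x ≠ 0` at the split places. [cite: Shelstad1979, §4 p. 22] -/
theorem hcSemireg_zero_two_hreg {S : Finset W} {w : W} {s : W → Fin 3 → ℝ} (hp : HcSemireg S w 0 2 s) :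
    s w 0 = s w 2 ∧ (∀ w', w' ∉ S → w' ≠ w → Circle.exp (s w' 0) ≠ Circle.exp (s w' 2)) ∧ (∀ w' ∈ S, s w' 0 ≠ 0) :=
  ⟨hp.1, fun w' hw' hne h => absurd (hp.2.2.1 w' hw' hne h) (by decide), hp.2.2.2⟩

end Generic

/-! ## §2 The covered-wall guard: at an indefinite place the wall `(w, 0, 2)` is noncompact -/

section Guard

variable (L : Type) [Field L] (α : Fin 3 → L)

/-- **At an INDEFINITE place slots `0` and `2` have opposite signs** (★ `lineOf`: slots `0, 1` = the two even-sign lines, slot `2` = the odd line, ★ `sign_apply_lineOf`; at a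
definite place all slot signs agree, which `IsIndefiniteAt (slotSign L α) w` excludes). [cite: Rogawski1990, §3.6 p. 31; §14.2 p. 232] -/
theorem slotSign_zero_ne_slotSign_two {w : {w : InfinitePlace L // IsComplex w}} (hα : ∀ i, α i ≠ 0) (hreal : ∀ i, (w.1.embedding (α i)).im = 0)
    (hind : IsIndefiniteAt (slotSign L α) w) : slotSign L α w 0 ≠ slotSign L α w 2 := by
  have hne : ∀ i, formSign L α w i ≠ 0 := fun i => by
    show SignType.sign (formRe L α w i) ≠ 0
    rw [Ne, sign_eq_zero_iff]
    exact formRe_ne_zero hα hreal i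
  by_cases hdef : formSign L α w 0 = formSign L α w 1 ∧ formSign L α w 1 = formSign L α w 2
  · -- definite place: every slot sign is the common sign — excluded by `hind`
    exfalso
    apply hind
    have hall : ∀ i, formSign L α w i = formSign L α w 0 := fun i => by
      fin_cases i
      · rfl
      · exact hdef.1.symm
      · exact (hdef.1.trans hdef.2).symm
    simp only [slotSign_apply, hall]
    exact ⟨trivial, trivial⟩
  · obtain ⟨_, h2⟩ := sign_apply_lineOf (hne 0) (hne 1) (hne 2) hdef
    rw [slotSign_apply, slotSign_apply, h2]
    have h0 := hne (lineOf (formSign L α w) 0)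
    revert h0
    generalize formSign L α w (lineOf (formSign L α w) 0) = t
    cases t <;> decide

end Guard

/-! ## §3 Organ J from its bricks -/

section Assembly

variable (L : Type) [Field L] [NumberField L] [IsCMField L] (α : Fin 3 → L)
  [MeasurableSpace ↥(arch (↥(maximalRealSubfield L)) L (IsCMField.complexConj L) 3 (Matrix.diagonal α))]
  [BorelSpace ↥(arch (↥(maximalRealSubfield L)) L (IsCMField.complexConj L) 3 (Matrix.diagonal α))]
  [MeasurableSpace (↥(arch (↥(maximalRealSubfield L)) L (IsCMField.complexConj L) 2 (Matrix.of fun i j : Fin 2 => if i.val + j.val + 1 = 2 then (1 : L) else 0)) ×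
      ↥(arch (↥(maximalRealSubfield L)) L (IsCMField.complexConj L) 1 (Matrix.of fun i j : Fin 1 => if i.val + j.val + 1 = 1 then (1 : L) else 0)))]
  [BorelSpace (↥(arch (↥(maximalRealSubfield L)) L (IsCMField.complexConj L) 2 (Matrix.of fun i j : Fin 2 => if i.val + j.val + 1 = 2 then (1 : L) else 0)) ×
      ↥(arch (↥(maximalRealSubfield L)) L (IsCMField.complexConj L) 1 (Matrix.of fun i j : Fin 1 => if i.val + j.val + 1 = 1 then (1 : L) else 0)))]
  (ν' : Measure ↥(arch (↥(maximalRealSubfield L)) L (IsCMField.complexConj L) 3 (Matrix.diagonal α))) [IsFiniteMeasureOnCompacts ν'] [ν'.IsMulRightInvariant]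
  (νH : Measure (↥(arch (↥(maximalRealSubfield L)) L (IsCMField.complexConj L) 2 (Matrix.of fun i j : Fin 2 => if i.val + j.val + 1 = 2 then (1 : L) else 0)) ×
      ↥(arch (↥(maximalRealSubfield L)) L (IsCMField.complexConj L) 1 (Matrix.of fun i j : Fin 1 => if i.val + j.val + 1 = 1 then (1 : L) else 0))))
  [IsFiniteMeasureOnCompacts νH] [νH.IsMulRightInvariant]

/-- **ORGAN J FROM ITS BRICKS, (I₃)-ONLY MEMBERSHIPS.**  Given the jump clauses (HC-I₃) `ArchHcJump (slotSign L α) jc′ (orbFamGExt ν′ a′)` for every `a′` and (BZ-I₃)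
`ArchBzJump jcH (stOrbFamH νH fH)` for every `fH`, and, for every admissible `S` and covered `w ∉ S`, the BRICKS at one `G`-semiregular point `s` of the wall `(w, 0, 2)`:
(JH) one `fH` whose family member jumps by `cH ·` its Cayley value, the Cayley value `≠ 0`; (JG′) one `a′` whose twisted member jumps by `cG′ ·` its twisted Cayley value, the
Cayley value `≠ 0`; (BOOK) `cH = 2·cG′` — then `jcH S w = 2 · jc′ S w 0 2` at every admissible covered wall, i.e. ★ `AgreesOnAdmissibleCoveredSlots L α jc′ jcH`.
[cite: Shelstad1979, Prop. 4.5 (p. 26); Thm. 4.7 (IIIb) (p. 31)] [cite: Bouaziz1994IntegralesOrbitales, §3.2 (I₃) p. 580; Rem. 2 p. 594] [cite: Rogawski1990, §8.2 Prop. 8.2.1 (c) p. 119] -/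
theorem agreesOnAdmissibleCoveredSlots_of_bricks' (hα : ∀ i, α i ≠ 0) (hreal : ∀ (w : {w : InfinitePlace L // IsComplex w}) (i : Fin 3), (w.1.embedding (α i)).im = 0)
    (jc' : Finset {w : InfinitePlace L // IsComplex w} → {w : InfinitePlace L // IsComplex w} → Fin 3 → Fin 3 → ℂ)
    (jcH : Finset {w : InfinitePlace L // IsComplex w} → {w : InfinitePlace L // IsComplex w} → ℂ)
    (hHC : ∀ a' : ↥(arch (↥(maximalRealSubfield L)) L (IsCMField.complexConj L) 3 (Matrix.diagonal α)) → ℂ,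
      ArchSmooth L 3 (Matrix.diagonal α) a' → ArchHcJump (slotSign L α) jc' (orbFamGExt L α ν' a'))
    (hBZ : ∀ fH : (↥(arch (↥(maximalRealSubfield L)) L (IsCMField.complexConj L) 2 (Matrix.of fun i j : Fin 2 => if i.val + j.val + 1 = 2 then (1 : L) else 0)) ×
        ↥(arch (↥(maximalRealSubfield L)) L (IsCMField.complexConj L) 1 (Matrix.of fun i j : Fin 1 => if i.val + j.val + 1 = 1 then (1 : L) else 0))) → ℂ,
      ArchSmooth₂ L fH → ArchBzJump jcH (stOrbFamH L νH fH))
    (hbricks : ∀ (S : Finset {w : InfinitePlace L // IsComplex w}) (w : {w : InfinitePlace L // IsComplex w}),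
      (∀ w' ∈ S, w' ∈ splitChartPlaces L α) → IsCoveredWall (slotSign L α) S w →
        ∃ (s : {w : InfinitePlace L // IsComplex w} → Fin 3 → ℝ) (cH cG : ℂ), HcSemireg S w 0 2 s ∧
          (∃ fH : (↥(arch (↥(maximalRealSubfield L)) L (IsCMField.complexConj L) 2 (Matrix.of fun i j : Fin 2 => if i.val + j.val + 1 = 2 then (1 : L) else 0)) ×
              ↥(arch (↥(maximalRealSubfield L)) L (IsCMField.complexConj L) 1 (Matrix.of fun i j : Fin 1 => if i.val + j.val + 1 = 1 then (1 : L) else 0))) → ℂ,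
            ArchSmooth₂ L fH ∧
              HasOneSidedJump (fun ν : ℝ => stOrbFamH L νH fH S (s + ν • nrm w)) (cH * stOrbFamH L νH fH (insert w S) (cayPt w s)) ∧
              stOrbFamH L νH fH (insert w S) (cayPt w s) ≠ 0) ∧
          (∃ a' : ↥(arch (↥(maximalRealSubfield L)) L (IsCMField.complexConj L) 3 (Matrix.diagonal α)) → ℂ,
            ArchSmooth L 3 (Matrix.diagonal α) a' ∧
              HasOneSidedJump (fun ν : ℝ => archERhoG S (s + ν • hcNrm w 0 2) * orbFamGExt L α ν' a' S (s + ν • hcNrm w 0 2))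
                (cG * (archERhoG (insert w S) (hcCayPt w 0 2 s) * orbFamGExt L α ν' a' (insert w S) (hcCayPt w 0 2 s))) ∧
              orbFamGExt L α ν' a' (insert w S) (hcCayPt w 0 2 s) ≠ 0) ∧
          cH = 2 * cG) :
    AgreesOnAdmissibleCoveredSlots L α jc' jcH := by
  intro S w hS hcov
  obtain ⟨s, cH, cG, hsr, ⟨fH, hfH, hJH, hneH⟩, ⟨a', ha', hJG, hneG⟩, hbook⟩ := hbricks S w hS hcov
  obtain ⟨hs02, hreg, hregS⟩ := hcSemireg_zero_two_hreg hsr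
  -- the `H`-side pin: `jcH S w = cH`
  have hH : jcH S w = cH := jcH_eq_of_hasOneSidedJump (hBZ fH hfH) hcov.1 hs02 hreg hregS hJH hneH
  -- the `G′`-side pin: `jc′ S w 0 2 = cG` (the wall `(0,2)` is noncompact at a covered place)
  have hG : jc' S w 0 2 = cG :=
    jc'_eq_of_hasOneSidedJump (hHC a' ha') hcov.1 (by decide) (slotSign_zero_ne_slotSign_two L α hα (hreal w) hcov.2) hsr hJG hneG
  rw [hH, hG, hbook]

/-- **ORGAN J FROM ITS BRICKS** (the shape of the leaf's organ J: FULL memberships as hypotheses).  (HC) every `orbFamGExt ν′ a′`, `a′ ∈ C_c^∞(G′_∞)`, lies in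
Harish-Chandra's space with constants `jc′`; (BZ) every `stOrbFamH νH fH`, `fH ∈ C_c^∞(H_∞)`, lies in Bouaziz's space with constants `jcH`; (BRICKS) as in
`agreesOnAdmissibleCoveredSlots_of_bricks'` ⟹ ★ `AgreesOnAdmissibleCoveredSlots L α jc′ jcH` (their (I₃) projections ★ `ArchBouazizSpaceH.jump`, `ArchHCSpaceG` clause 5).
[cite: Shelstad1979, Thm. 4.7 (IIIb) (p. 31)] [cite: Bouaziz1994IntegralesOrbitales, §3.2 (I₃) p. 580; Rem. 2 p. 594] [cite: Rogawski1990, §8.2 Prop. 8.2.1 (c) p. 119] -/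
theorem agreesOnAdmissibleCoveredSlots_of_bricks (hα : ∀ i, α i ≠ 0) (hreal : ∀ (w : {w : InfinitePlace L // IsComplex w}) (i : Fin 3), (w.1.embedding (α i)).im = 0)
    (jc' : Finset {w : InfinitePlace L // IsComplex w} → {w : InfinitePlace L // IsComplex w} → Fin 3 → Fin 3 → ℂ)
    (jcH : Finset {w : InfinitePlace L // IsComplex w} → {w : InfinitePlace L // IsComplex w} → ℂ)
    (hHC : ∀ a' : ↥(arch (↥(maximalRealSubfield L)) L (IsCMField.complexConj L) 3 (Matrix.diagonal α)) → ℂ,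
      ArchSmooth L 3 (Matrix.diagonal α) a' → ArchHCSpaceG (slotSign L α) jc' (orbFamGExt L α ν' a'))
    (hBZ : ∀ fH : (↥(arch (↥(maximalRealSubfield L)) L (IsCMField.complexConj L) 2 (Matrix.of fun i j : Fin 2 => if i.val + j.val + 1 = 2 then (1 : L) else 0)) ×
        ↥(arch (↥(maximalRealSubfield L)) L (IsCMField.complexConj L) 1 (Matrix.of fun i j : Fin 1 => if i.val + j.val + 1 = 1 then (1 : L) else 0))) → ℂ,
      ArchSmooth₂ L fH → ArchBouazizSpaceH jcH (stOrbFamH L νH fH))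
    (hbricks : ∀ (S : Finset {w : InfinitePlace L // IsComplex w}) (w : {w : InfinitePlace L // IsComplex w}),
      (∀ w' ∈ S, w' ∈ splitChartPlaces L α) → IsCoveredWall (slotSign L α) S w →
        ∃ (s : {w : InfinitePlace L // IsComplex w} → Fin 3 → ℝ) (cH cG : ℂ), HcSemireg S w 0 2 s ∧
          (∃ fH : (↥(arch (↥(maximalRealSubfield L)) L (IsCMField.complexConj L) 2 (Matrix.of fun i j : Fin 2 => if i.val + j.val + 1 = 2 then (1 : L) else 0)) ×
              ↥(arch (↥(maximalRealSubfield L)) L (IsCMField.complexConj L) 1 (Matrix.of fun i j : Fin 1 => if i.val + j.val + 1 = 1 then (1 : L) else 0))) → ℂ,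
            ArchSmooth₂ L fH ∧
              HasOneSidedJump (fun ν : ℝ => stOrbFamH L νH fH S (s + ν • nrm w)) (cH * stOrbFamH L νH fH (insert w S) (cayPt w s)) ∧
              stOrbFamH L νH fH (insert w S) (cayPt w s) ≠ 0) ∧
          (∃ a' : ↥(arch (↥(maximalRealSubfield L)) L (IsCMField.complexConj L) 3 (Matrix.diagonal α)) → ℂ,
            ArchSmooth L 3 (Matrix.diagonal α) a' ∧
              HasOneSidedJump (fun ν : ℝ => archERhoG S (s + ν • hcNrm w 0 2) * orbFamGExt L α ν' a' S (s + ν • hcNrm w 0 2))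
                (cG * (archERhoG (insert w S) (hcCayPt w 0 2 s) * orbFamGExt L α ν' a' (insert w S) (hcCayPt w 0 2 s))) ∧
              orbFamGExt L α ν' a' (insert w S) (hcCayPt w 0 2 s) ≠ 0) ∧
          cH = 2 * cG) :
    AgreesOnAdmissibleCoveredSlots L α jc' jcH :=
  agreesOnAdmissibleCoveredSlots_of_bricks' L α ν' νH hα hreal jc' jcH (fun a' ha' => (hHC a' ha').2.2.2.2) (fun fH hfH => (hBZ fH hfH).jump) hbricks

end Assembly

end Literature.NumberTheory.Rogawski1990

end
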